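import Mathlib.Analysis.SpecialFunctions.Trigonometric.Bounds
import Mathlib.MeasureTheory.Integral.IntervalIntegral.FundThmCalculus
import Mathlib.Probability.Process.Adapted
import Literature.Probability.RandomPlanarGeometry.LoewnerAdapted
import HarnessLib

/-!
# The radial Bessel flow: the boundary process of radial Loewner chains, pathwise

Topic `Probability/RandomPlanarGeometry` (trunk T-STOCH). For the **radial** Loewner chain in
the unit disc driven by a continuous function `U`, `∂ₜ gₜ(z) = -gₜ(z) (gₜ(z) + e^{iUₜ})/(gₜ(z) - e^{iUₜ})`
(Lawler–Schramm–Werner (2002), (2.5); Lawler (2005), §4.2 and §6.4 (6.11)), a boundary point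
`e^{iθ}` stays on the unit circle until it is swallowed, and its *argument seen from the driving
point*, `Yₜ = arg gₜ(e^{iθ}) - Uₜ` (continuous branch), solves the real equation
`Ẏₜ + U̇ₜ = cot(Yₜ/2)`, i.e.
```
  Yₜ = θ + ∫₀ᵗ cot(Y_s/2) ds - (Uₜ - U₀),        0 < Yₜ < 2π,
```
up to the first time `Yₜ ∈ {0, 2π}` (Lawler (2005), §6.4, eq. (6.12): "`ḣₜ(z) = cot[(hₜ(z) - √κ Bₜ)/2]`
… if `z = x ∈ ℝ`, this is a real differential equation for `hₜ(x) = arg gₜ(e^{ix})`. If we let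
`Yₜ = hₜ(z) - √κ Bₜ` … then `dYₜ = cot(Yₜ/2) dt + √κ dWₜ`"; LSW (2002), (2.9)–(2.11):
"`Yₜ := -i log gₜ(e^{iθ}) - √κ Bₜ` … `dYₜ = cot(Yₜ/2) dt - √κ dBₜ`"). For `U = √κ B` this is the
**radial Bessel process** of Lawler (2005), §1.11, eq. (1.16) (`dX = (a/2) cot(X/2) dt + dB`,
`a = 2/κ`, after the time change `t ↦ t/κ`, (6.13)), the one-dimensional diffusion behind the
disconnection / one-arm exponents of radial SLE_κ (LSW (2002), Lemma 2.2 and Thm. 1.3; Lawler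
(2005), §6.11).

This file constructs that process **pathwise, for every continuous driving function**, as an
everywhere-defined measurable functional of the path, in the form needed by the Itô calculus of
the tree (`Literature.Analysis.FunctionSpaces.IsItoProcess`: `X = X₀ + ∫ b ds + ∫ σ dB` for *all*
times). Since the drift `cot(y/2)` blows up at `y ∈ {0, 2π}`, we follow the truncation device of
`LoewnerAdapted` (chordal case, field `2/max(h - W, δ)`): for a level `0 < δ ≤ π/2` the
**clamped cotangent** `cotTrunc δ x = cot(clamp of x to [δ, π - δ])` is bounded (`≤ cot δ`) and
globally Lipschitz (`1/sin²δ`), so the truncated equation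
```
  Y^δₜ = θ + ∫₀ᵗ cotTrunc δ (Y^δ_s/2) ds - (Uₜ - U₀)
```
has a unique global solution, given on each horizon `[0, t]` by Mathlib's Picard–Lindelöf
theorem applied to `Zₜ = Y^δₜ + (Uₜ - U₀)`, `Ż = cotTrunc δ ((Z - (U - U₀))/2)`
(`radialField`), with the path stopped at `t` so that the solution is a measurable functional of
the path up to time `t` (`Literature.Analysis.ODE.measurable_picardSolution`). The truncated flow
agrees with the true one as long as `Y^δ ∈ [2δ, 2π - 2δ]`; exit times, the removal of the
truncation and the stochastic analysis (`U = √κ B`) are in the sequels.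

Contents (all proved; no named fact is introduced):

* `cotTrunc δ` and its API (`cotTrunc_eq_cot` on `[δ, π - δ]`, `abs_cotTrunc_le`,
  `lipschitzWith_cotTrunc`, continuity, measurability), from the elementary identity
  `cot a - cot b = sin(b - a)/(sin a sin b)` (`cot_sub_cot`);
* the truncated radial field `radialField U δ s z = cotTrunc δ ((z - (U_s - U₀))/2)` and its
  Picard–Lindelöf hypotheses on every `[0, T]` (`isPicardLindelof_radialField`);
* for a family of continuous paths `U ω` on a measurable space: the truncated solutions
  `truncSol` (one per horizon, consistent: `truncSol_eq_truncSol_of_le`), the **truncated radial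
  Bessel flow** `argTrunc … θ : ℝ≥0 → Ω → ℝ` with `argTrunc 0 = θ`, continuous paths
  (`continuous_argTrunc`), the integrated equation
  `Y^δₜ = θ + ∫₀ᵗ cotTrunc δ (Y^δ_s/2) ds - (Uₜ - U₀)` for all `t` (`argTrunc_eq_integral`),
  uniqueness of continuous solutions of that equation (`eqOn_argTrunc_of_integral_eq`), and
  measurability of `ω ↦ Y^δₜ(ω)` with respect to any σ-algebra making the path values at times
  `≤ t` measurable (`measurable_argTrunc`), whence adaptedness to a filtration to which the path is
  adapted (`adapted_argTrunc`).

## Mathlib / Literature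

USED: Mathlib's `IsPicardLindelof`, `ODE_solution_unique`,
`intervalIntegral.integral_eq_sub_of_hasDeriv_right_of_le`, `Real.cot`; the tree's
`Literature.Analysis.ODE.picardSolution` / `measurable_picardSolution` (`MeasurablePicardLindelof`)
and `Loewner.stoppedPath` (`LoewnerAdapted`). Mathlib has no radial Loewner equation and no API for
`Real.cot` beyond `Real.cot_eq_cos_div_sin` (searched `cot`, `radial`, `Loewner`).

## References

* G. F. Lawler, *Conformally Invariant Processes in the Plane*, AMS (2005): §1.11 eq. (1.16)
  (the Bessel-like process `dX = (a/2) cot(X/2) dt + dB` on `(0, 2π)`), §6.4 eqs. (6.12)–(6.13)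
  (the boundary flow of radial SLE_κ), §6.11 eq. (6.34). [Lawler2005]
* G. F. Lawler, O. Schramm, W. Werner, *One-arm exponent for critical 2D percolation*, Electron.
  J. Probab. 7 (2002), no. 2: (2.5), (2.9)–(2.11). [LawlerSchrammWernerEJP2002]
-/

noncomputable section

open Set Filter Topology MeasureTheory Metric

namespace Literature.Probability.RandomPlanarGeometry

namespace RadialLoewner

open scoped NNReal
open Real (cot sin cos pi)

/-! ### The clamped cotangent drift -/

section CotTrunc

variable {δ x y : ℝ}

/-- The clamp of `x` to the interval `[δ, π - δ]`. [folklore] -/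
def clampI (δ x : ℝ) : ℝ :=
  max δ (min x (Real.pi - δ))

/-- The clamp lands in `[δ, π - δ]` (for `δ ≤ π/2`). [folklore] -/
theorem clampI_mem (hδ' : δ ≤ Real.pi / 2) (x : ℝ) : clampI δ x ∈ Icc δ (Real.pi - δ) :=
  ⟨le_max_left _ _, max_le (by linarith) (min_le_right _ _)⟩

/-- On `[δ, π - δ]` the clamp is the identity. [folklore] -/
theorem clampI_of_mem (hx : x ∈ Icc δ (Real.pi - δ)) : clampI δ x = x := by
  rw [clampI, min_eq_left hx.2, max_eq_right hx.1]

/-- The clamp is `1`-Lipschitz. [folklore] -/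
theorem abs_clampI_sub_clampI_le (δ x y : ℝ) : |clampI δ x - clampI δ y| ≤ |x - y| := by
  unfold clampI
  calc |max δ (min x (Real.pi - δ)) - max δ (min y (Real.pi - δ))|
      ≤ max |δ - δ| |min x (Real.pi - δ) - min y (Real.pi - δ)| := abs_max_sub_max_le_max _ _ _ _
    _ ≤ max |δ - δ| (max |x - y| |Real.pi - δ - (Real.pi - δ)|) :=
        max_le_max le_rfl (abs_min_sub_min_le_max _ _ _ _)
    _ = |x - y| := by simp [abs_nonneg]

/-- The clamp is continuous. [folklore] -/
theorem continuous_clampI (δ : ℝ) : Continuous (clampI δ) :=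
  continuous_const.max (continuous_id.min continuous_const)

/-- The clamp is measurable. [folklore] -/
theorem measurable_clampI (δ : ℝ) : Measurable (clampI δ) :=
  (continuous_clampI δ).measurable

/-- **The clamped cotangent** `cotTrunc δ x = cot (clamp of x to [δ, π - δ])`: the drift
`cot(y/2)` of the radial Bessel equation (Lawler (2005), (1.16), (6.12); LSW (2002), (2.11)),
evaluated at `x = y/2` clamped away from the singularities `0` and `π`. A technical device (no
claim of provenance), the radial analogue of `Loewner.truncField`. [folklore] -/
def cotTrunc (δ x : ℝ) : ℝ :=
  Real.cot (clampI δ x)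

/-- Unfolding of `cotTrunc` as a quotient. [folklore] -/
theorem cotTrunc_eq_cos_div_sin (δ x : ℝ) :
    cotTrunc δ x = Real.cos (clampI δ x) / Real.sin (clampI δ x) := by
  rw [cotTrunc, Real.cot_eq_cos_div_sin]

/-- On `[δ, π - δ]` the clamped cotangent is the cotangent. [folklore] -/
theorem cotTrunc_eq_cot (hx : x ∈ Icc δ (Real.pi - δ)) : cotTrunc δ x = Real.cot x := by
  rw [cotTrunc, clampI_of_mem hx]

/-- `sin` is positive on `[δ, π - δ]` (`0 < δ`). [folklore] -/
theorem sin_pos_of_mem (hδ : 0 < δ) (hx : x ∈ Icc δ (Real.pi - δ)) : 0 < Real.sin x :=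
  Real.sin_pos_of_pos_of_lt_pi (hδ.trans_le hx.1) (by linarith [hx.2])

/-- `sin δ ≤ sin x` on `[δ, π - δ]` (`0 < δ ≤ π/2`). [folklore] -/
theorem sin_le_sin_of_mem (hδ : 0 < δ) (hδ' : δ ≤ Real.pi / 2) (hx : x ∈ Icc δ (Real.pi - δ)) :
    Real.sin δ ≤ Real.sin x := by
  rcases le_or_gt x (Real.pi / 2) with h | h
  · exact Real.sin_le_sin_of_le_of_le_pi_div_two (by linarith [Real.pi_pos]) h hx.1
  · rw [← Real.sin_pi_sub x]
    exact Real.sin_le_sin_of_le_of_le_pi_div_two (by linarith [Real.pi_pos]) (by linarith)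
      (by linarith [hx.2])

/-- `0 < sin δ` for `0 < δ ≤ π/2`. [folklore] -/
theorem sin_level_pos (hδ : 0 < δ) (hδ' : δ ≤ Real.pi / 2) : 0 < Real.sin δ :=
  Real.sin_pos_of_pos_of_lt_pi hδ (by linarith [Real.pi_pos])

/-- **`cot a - cot b = sin (b - a) / (sin a sin b)`** (non-vanishing sines). [folklore] -/
theorem cot_sub_cot {a b : ℝ} (ha : Real.sin a ≠ 0) (hb : Real.sin b ≠ 0) :
    Real.cot a - Real.cot b = Real.sin (b - a) / (Real.sin a * Real.sin b) := by
  rw [Real.cot_eq_cos_div_sin, Real.cot_eq_cos_div_sin, Real.sin_sub,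
    div_sub_div _ _ ha hb]
  ring

/-- `cot δ ≥ 0` for `0 < δ ≤ π/2`. [folklore] -/
theorem cot_level_nonneg (hδ : 0 < δ) (hδ' : δ ≤ Real.pi / 2) : 0 ≤ Real.cot δ := by
  rw [Real.cot_eq_cos_div_sin]
  exact div_nonneg (Real.cos_nonneg_of_neg_pi_div_two_le_of_le (by linarith) hδ')
    (sin_level_pos hδ hδ').le

/-- **`|cot x| ≤ cot δ` on `[δ, π - δ]`** (`cot` is decreasing on `(0, π)` and
`cot (π - δ) = -cot δ`). [folklore] -/
theorem abs_cot_le_of_mem (hδ : 0 < δ) (hδ' : δ ≤ Real.pi / 2) (hx : x ∈ Icc δ (Real.pi - δ)) :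
    |Real.cot x| ≤ Real.cot δ := by
  have hsx : 0 < Real.sin x := sin_pos_of_mem hδ hx
  have hsδ : 0 < Real.sin δ := sin_level_pos hδ hδ'
  have hsπδ : 0 < Real.sin (Real.pi - δ) := by rw [Real.sin_pi_sub]; exact hsδ
  rw [abs_le]
  constructor
  · -- `cot x - cot (π - δ) = sin (π - δ - x)/(sin x sin (π - δ)) ≥ 0` and `cot (π - δ) = -cot δ`
    have h1 : Real.cot x - Real.cot (Real.pi - δ) =
        Real.sin (Real.pi - δ - x) / (Real.sin x * Real.sin (Real.pi - δ)) :=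
      cot_sub_cot hsx.ne' hsπδ.ne'
    have h2 : 0 ≤ Real.sin (Real.pi - δ - x) :=
      Real.sin_nonneg_of_nonneg_of_le_pi (by linarith [hx.2]) (by linarith [hx.1])
    have h3 : 0 ≤ Real.cot x - Real.cot (Real.pi - δ) := by
      rw [h1]; positivity
    have h4 : Real.cot (Real.pi - δ) = -Real.cot δ := by
      rw [Real.cot_eq_cos_div_sin, Real.cot_eq_cos_div_sin, Real.sin_pi_sub, Real.cos_pi_sub,
        neg_div]
    linarith
  · have h1 : Real.cot δ - Real.cot x = Real.sin (x - δ) / (Real.sin δ * Real.sin x) :=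
      cot_sub_cot hsδ.ne' hsx.ne'
    have h2 : 0 ≤ Real.sin (x - δ) :=
      Real.sin_nonneg_of_nonneg_of_le_pi (by linarith [hx.1]) (by linarith [hx.2])
    have h3 : 0 ≤ Real.cot δ - Real.cot x := by rw [h1]; positivity
    linarith

/-- **`cot` is `1/sin²δ`-Lipschitz on `[δ, π - δ]`**: `|cot x - cot y| ≤ |x - y| / sin²δ`, from
`cot x - cot y = sin (y - x)/(sin x sin y)`, `|sin u| ≤ |u|` and `sin x, sin y ≥ sin δ`.
[folklore] -/
theorem abs_cot_sub_cot_le (hδ : 0 < δ) (hδ' : δ ≤ Real.pi / 2) (hx : x ∈ Icc δ (Real.pi - δ))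
    (hy : y ∈ Icc δ (Real.pi - δ)) :
    |Real.cot x - Real.cot y| ≤ |x - y| / Real.sin δ ^ 2 := by
  have hsx : 0 < Real.sin x := sin_pos_of_mem hδ hx
  have hsy : 0 < Real.sin y := sin_pos_of_mem hδ hy
  have hsδ : 0 < Real.sin δ := sin_level_pos hδ hδ'
  have hδx := sin_le_sin_of_mem hδ hδ' hx
  have hδy := sin_le_sin_of_mem hδ hδ' hy
  rw [cot_sub_cot hsx.ne' hsy.ne', abs_div, abs_of_pos (mul_pos hsx hsy),
    div_le_div_iff₀ (mul_pos hsx hsy) (pow_pos hsδ 2)]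
  have h1 : |Real.sin (y - x)| ≤ |x - y| := by
    rw [abs_sub_comm x y]; exact Real.abs_sin_le_abs
  calc |Real.sin (y - x)| * Real.sin δ ^ 2 ≤ |x - y| * Real.sin δ ^ 2 :=
        mul_le_mul_of_nonneg_right h1 (sq_nonneg _)
    _ = |x - y| * (Real.sin δ * Real.sin δ) := by rw [sq]
    _ ≤ |x - y| * (Real.sin x * Real.sin y) :=
        mul_le_mul_of_nonneg_left (mul_le_mul hδx hδy hsδ.le hsx.le) (abs_nonneg _)

/-- The clamped cotangent is bounded by `cot δ` (`0 < δ ≤ π/2`). [folklore] -/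
theorem abs_cotTrunc_le (hδ : 0 < δ) (hδ' : δ ≤ Real.pi / 2) (x : ℝ) :
    |cotTrunc δ x| ≤ Real.cot δ :=
  abs_cot_le_of_mem hδ hδ' (clampI_mem hδ' x)

/-- **The clamped cotangent is globally `1/sin²δ`-Lipschitz** (`0 < δ ≤ π/2`). [folklore] -/
theorem lipschitzWith_cotTrunc (hδ : 0 < δ) (hδ' : δ ≤ Real.pi / 2) :
    LipschitzWith (1 / Real.sin δ ^ 2).toNNReal (cotTrunc δ) := by
  refine LipschitzWith.of_dist_le_mul fun x y ↦ ?_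
  rw [Real.coe_toNNReal _ (by positivity), Real.dist_eq, Real.dist_eq, cotTrunc, cotTrunc]
  calc |Real.cot (clampI δ x) - Real.cot (clampI δ y)|
      ≤ |clampI δ x - clampI δ y| / Real.sin δ ^ 2 :=
        abs_cot_sub_cot_le hδ hδ' (clampI_mem hδ' x) (clampI_mem hδ' y)
    _ ≤ |x - y| / Real.sin δ ^ 2 :=
        div_le_div_of_nonneg_right (abs_clampI_sub_clampI_le δ x y) (sq_nonneg _)
    _ = 1 / Real.sin δ ^ 2 * |x - y| := by ring

/-- The clamped cotangent is continuous (`0 < δ ≤ π/2`). [folklore] -/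
theorem continuous_cotTrunc (hδ : 0 < δ) (hδ' : δ ≤ Real.pi / 2) : Continuous (cotTrunc δ) :=
  (lipschitzWith_cotTrunc hδ hδ').continuous

/-- The clamped cotangent is measurable (any `δ`). [folklore] -/
theorem measurable_cotTrunc (δ : ℝ) : Measurable (cotTrunc δ) := by
  have : cotTrunc δ = fun x ↦ Real.cos (clampI δ x) / Real.sin (clampI δ x) :=
    funext fun x ↦ cotTrunc_eq_cos_div_sin δ x
  rw [this]
  exact (Real.measurable_cos.comp (measurable_clampI δ)).div
    (Real.measurable_sin.comp (measurable_clampI δ))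

end CotTrunc

/-! ### The truncated radial field -/

section Field

variable (U : ℝ≥0 → ℝ) (δ : ℝ)

/-- **The truncated radial field** `F_δ(s, z) = cotTrunc δ ((z - (U_s - U₀))/2)`: the equation
`Ż = cot((Z - (U - U₀))/2)` for `Z = Y + (U - U₀)` (Lawler (2005), (6.12) with `hₜ = Z`, `Y` as
in the module docstring), with the cotangent clamped at level `δ`. Time `s : ℝ` is read in `ℝ≥0`
through `Real.toNNReal`, as in `Loewner.vectorField`. [folklore] -/
def radialField (s z : ℝ) : ℝ :=
  cotTrunc δ ((z - (U s.toNNReal - U 0)) / 2)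

variable {U δ}

/-- Unfolding of `radialField`. [folklore] -/
theorem radialField_apply (s z : ℝ) :
    radialField U δ s z = cotTrunc δ ((z - (U s.toNNReal - U 0)) / 2) := rfl

/-- The truncated radial field is bounded by `cot δ`. [folklore] -/
theorem abs_radialField_le (hδ : 0 < δ) (hδ' : δ ≤ Real.pi / 2) (s z : ℝ) :
    |radialField U δ s z| ≤ Real.cot δ :=
  abs_cotTrunc_le hδ hδ' _

/-- The truncated radial field is globally `1/(2 sin²δ)`-Lipschitz in the space variable.
[folklore] -/
theorem lipschitzWith_radialField (hδ : 0 < δ) (hδ' : δ ≤ Real.pi / 2) (s : ℝ) :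
    LipschitzWith (1 / (2 * Real.sin δ ^ 2)).toNNReal (radialField U δ s) := by
  refine LipschitzWith.of_dist_le_mul fun z₁ z₂ ↦ ?_
  have hL := (lipschitzWith_cotTrunc hδ hδ').dist_le_mul ((z₁ - (U s.toNNReal - U 0)) / 2)
    ((z₂ - (U s.toNNReal - U 0)) / 2)
  rw [Real.coe_toNNReal _ (by positivity)] at hL ⊢
  rw [radialField, radialField]
  refine hL.trans (le_of_eq ?_)
  rw [Real.dist_eq, Real.dist_eq, show (z₁ - (U s.toNNReal - U 0)) / 2 -
    (z₂ - (U s.toNNReal - U 0)) / 2 = (z₁ - z₂) / 2 by ring, abs_div, abs_two]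
  ring

/-- The truncated radial field is continuous in time (continuous driving function). [folklore] -/
theorem continuous_radialField_left (hU : Continuous U) (hδ : 0 < δ) (hδ' : δ ≤ Real.pi / 2)
    (z : ℝ) : Continuous fun s ↦ radialField U δ s z := by
  unfold radialField
  exact (continuous_cotTrunc hδ hδ').comp ((continuous_const.sub
    ((hU.comp continuous_real_toNNReal).sub continuous_const)).div_const _)

/-- The truncated radial field is jointly continuous (continuous driving function). [folklore] -/
theorem continuous_radialField_uncurry (hU : Continuous U) (hδ : 0 < δ) (hδ' : δ ≤ Real.pi / 2) :
    Continuous (Function.uncurry (radialField U δ)) := by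
  unfold radialField Function.uncurry
  exact (continuous_cotTrunc hδ hδ').comp ((continuous_snd.sub
    ((hU.comp (continuous_real_toNNReal.comp continuous_fst)).sub continuous_const)).div_const _)

/-- The truncated radial field along a continuous curve is continuous in time. [folklore] -/
theorem continuous_radialField_comp (hU : Continuous U) (hδ : 0 < δ) (hδ' : δ ≤ Real.pi / 2)
    {Z : ℝ → ℝ} (hZ : Continuous Z) : Continuous fun s ↦ radialField U δ s (Z s) := by
  unfold radialField
  exact (continuous_cotTrunc hδ hδ').comp ((hZ.sub
    ((hU.comp continuous_real_toNNReal).sub continuous_const)).div_const _)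

/-- **Picard–Lindelöf hypotheses for the truncated radial field** on `[0, T]` from any initial
value (radius of initial data `0`): Lipschitz constant `1/(2 sin²δ)`, bound `cot δ`, ball radius
`T cot δ + 1`. [folklore] -/
theorem isPicardLindelof_radialField (hU : Continuous U) (hδ : 0 < δ) (hδ' : δ ≤ Real.pi / 2)
    {T : ℝ} (hT : 0 ≤ T) (z : ℝ) :
    IsPicardLindelof (radialField U δ) (⟨0, le_rfl, hT⟩ : Icc (0 : ℝ) T) z
      (Real.cot δ * T + 1).toNNReal 0 (Real.cot δ).toNNReal (1 / (2 * Real.sin δ ^ 2)).toNNReal where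
  lipschitzOnWith s _ := (lipschitzWith_radialField hδ hδ' s).lipschitzOnWith
  continuousOn x _ := (continuous_radialField_left hU hδ hδ' x).continuousOn
  norm_le s _ x _ := by
    rw [Real.norm_eq_abs, Real.coe_toNNReal _ (cot_level_nonneg hδ hδ')]
    exact abs_radialField_le hδ hδ' s x
  mul_max_le := by
    have hc := cot_level_nonneg hδ hδ'
    rw [Real.coe_toNNReal _ hc, Real.coe_toNNReal _ (by positivity), NNReal.coe_zero]
    have hmax : max (T - (0 : ℝ)) ((0 : ℝ) - 0) = T := by
      rw [sub_zero, sub_self, max_eq_left hT]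
    rw [hmax]
    linarith

end Field

/-! ### A measurable family of driving paths: the truncated radial Bessel flow -/

section Parametrised

variable {Ω : Type*} {mΩ : MeasurableSpace Ω} (U : Ω → ℝ≥0 → ℝ) (t : ℝ≥0)

variable {U t}

/-- The Picard–Lindelöf hypotheses for the truncated radial fields of the stopped paths,
uniformly in `ω`. [folklore] -/
theorem isPicardLindelof_radialField_stoppedPath (hc : ∀ ω, Continuous (U ω)) {δ : ℝ}
    (hδ : 0 < δ) (hδ' : δ ≤ Real.pi / 2) (θ : ℝ) (ω : Ω) :
    IsPicardLindelof (radialField (Loewner.stoppedPath U t ω) δ)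
      (⟨0, le_rfl, t.coe_nonneg⟩ : Icc (0 : ℝ) t) θ (Real.cot δ * t + 1).toNNReal 0
      (Real.cot δ).toNNReal (1 / (2 * Real.sin δ ^ 2)).toNNReal :=
  isPicardLindelof_radialField (Loewner.continuous_stoppedPath (hc ω)) hδ hδ' t.coe_nonneg θ

/-- **The truncated solution on the horizon `[0, t]`**: for each `ω`, the solution of
`Ż = cotTrunc δ ((Z - (U ω - U ω 0))/2)`, `Z(0) = θ`, on `[0, t]` (path stopped at `t`), chosen by
the Picard scheme, hence measurable in `ω` (`measurable_truncSol`). [folklore] -/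
def truncSol (hc : ∀ ω, Continuous (U ω)) {δ : ℝ} (hδ : 0 < δ) (hδ' : δ ≤ Real.pi / 2) (θ : ℝ) :
    Ω → ℝ → ℝ :=
  Literature.Analysis.ODE.picardSolution
    (isPicardLindelof_radialField_stoppedPath (U := U) (t := t) hc hδ hδ' θ)
    (mem_closedBall_self le_rfl)

/-- The truncated solution starts at `θ`. [folklore] -/
theorem truncSol_zero (hc : ∀ ω, Continuous (U ω)) {δ : ℝ} (hδ : 0 < δ) (hδ' : δ ≤ Real.pi / 2) (θ : ℝ) (ω : Ω) : truncSol (t := t) hc hδ hδ' θ ω 0 = θ :=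
  (Literature.Analysis.ODE.picardSolution_spec
    (isPicardLindelof_radialField_stoppedPath (U := U) (t := t) hc hδ hδ' θ)
    (mem_closedBall_self le_rfl) ω).1

/-- The stopped path and the path have the same truncated radial field on `[0, t]`. [folklore] -/
theorem radialField_stoppedPath_of_mem (ω : Ω) (δ : ℝ) {s : ℝ} (hs : s ∈ Icc (0 : ℝ) t) (z : ℝ) :
    radialField (Loewner.stoppedPath U t ω) δ s z = radialField (U ω) δ s z := by
  simp only [radialField, Loewner.stoppedPath_zero]
  rw [Loewner.stoppedPath_of_le ((Real.toNNReal_le_iff_le_coe).2 hs.2)]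

/-- The truncated solution solves the truncated radial equation of the (unstopped) path on
`[0, t]`. [folklore] -/
theorem hasDerivWithinAt_truncSol (hc : ∀ ω, Continuous (U ω)) {δ : ℝ} (hδ : 0 < δ) (hδ' : δ ≤ Real.pi / 2) (θ : ℝ) (ω : Ω) {s : ℝ} (hs : s ∈ Icc (0 : ℝ) t) :
    HasDerivWithinAt (truncSol (t := t) hc hδ hδ' θ ω)
      (radialField (U ω) δ s (truncSol (t := t) hc hδ hδ' θ ω s)) (Icc (0 : ℝ) t) s := by
  have h := (Literature.Analysis.ODE.picardSolution_spec
    (isPicardLindelof_radialField_stoppedPath (U := U) (t := t) hc hδ hδ' θ)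
    (mem_closedBall_self le_rfl) ω).2 s hs
  rw [radialField_stoppedPath_of_mem ω δ hs] at h
  exact h

/-- The truncated solution is continuous in time. [folklore] -/
theorem continuous_truncSol (hc : ∀ ω, Continuous (U ω)) {δ : ℝ} (hδ : 0 < δ) (hδ' : δ ≤ Real.pi / 2) (θ : ℝ) (ω : Ω) : Continuous (truncSol (t := t) hc hδ hδ' θ ω) :=
  Literature.Analysis.ODE.continuous_picardSolution _ _ ω

/-- The truncated radial fields of the stopped paths are jointly measurable in
`(ω, time, space)` (continuous paths, measurable values up to time `t`). [folklore] -/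
theorem measurable_radialField_stoppedPath (hc : ∀ ω, Continuous (U ω)) (hmeas : ∀ s, s ≤ t → Measurable fun ω ↦ U ω s)
    (δ : ℝ) :
    Measurable fun p : Ω × ℝ × ℝ ↦ radialField (Loewner.stoppedPath U t p.1) δ p.2.1 p.2.2 := by
  unfold radialField
  have h1 : Measurable fun p : Ω × ℝ × ℝ ↦ Loewner.stoppedPath U t p.1 p.2.1.toNNReal :=
    (Loewner.measurable_stoppedPath_uncurry hc hmeas).comp
      (measurable_fst.prodMk measurable_snd.fst)
  have h0 : Measurable fun p : Ω × ℝ × ℝ ↦ Loewner.stoppedPath U t p.1 0 := by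
    simp only [Loewner.stoppedPath_zero]
    exact (hmeas 0 (zero_le : (0 : ℝ≥0) ≤ t)).comp measurable_fst
  exact (measurable_cotTrunc δ).comp ((measurable_snd.snd.sub (h1.sub h0)).div_const _)

/-- **The truncated solution is measurable in `ω`** at each time, when the path values at times
`≤ t` are measurable (`MeasurablePicardLindelof.measurable_picardSolution`). [folklore] -/
theorem measurable_truncSol (hc : ∀ ω, Continuous (U ω)) {δ : ℝ} (hδ : 0 < δ) (hδ' : δ ≤ Real.pi / 2) (hmeas : ∀ s, s ≤ t → Measurable fun ω ↦ U ω s) (θ : ℝ) (s : ℝ) :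
    Measurable fun ω ↦ truncSol (t := t) hc hδ hδ' θ ω s :=
  Literature.Analysis.ODE.measurable_picardSolution _ _
    (measurable_radialField_stoppedPath hc hmeas δ) s

/-- A solution of the truncated equation on `[0, t]` has right derivatives on `[0, t)`.
[folklore] -/
theorem hasDerivWithinAt_Ici_of_Icc {Z : ℝ → ℝ} {t : ℝ} {F : ℝ → ℝ → ℝ}
    (hZ : ∀ s ∈ Icc (0 : ℝ) t, HasDerivWithinAt Z (F s (Z s)) (Icc (0 : ℝ) t) s) {s : ℝ}
    (hs : s ∈ Ico (0 : ℝ) t) : HasDerivWithinAt Z (F s (Z s)) (Ici s) s :=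
  (hZ s (Ico_subset_Icc_self hs)).mono_of_mem_nhdsWithin
    (mem_of_superset (Icc_mem_nhdsGE hs.2) (Icc_subset_Icc hs.1 le_rfl))

/-- **Uniqueness for the truncated equation**: two solutions of `Ż = F_δ(s, Z)` on `[0, t]` with
the same initial value agree on `[0, t]` (the field is globally Lipschitz: Grönwall, Mathlib
`ODE_solution_unique`). [folklore] -/
theorem eqOn_of_hasDerivWithinAt {δ : ℝ} (hδ : 0 < δ) (hδ' : δ ≤ Real.pi / 2) {V : ℝ≥0 → ℝ} {Z₁ Z₂ : ℝ → ℝ} {t : ℝ}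
    (h₁ : ∀ s ∈ Icc (0 : ℝ) t, HasDerivWithinAt Z₁ (radialField V δ s (Z₁ s)) (Icc (0 : ℝ) t) s)
    (h₂ : ∀ s ∈ Icc (0 : ℝ) t, HasDerivWithinAt Z₂ (radialField V δ s (Z₂ s)) (Icc (0 : ℝ) t) s)
    (h0 : Z₁ 0 = Z₂ 0) : EqOn Z₁ Z₂ (Icc (0 : ℝ) t) :=
  ODE_solution_unique (v := radialField V δ) (K := (1 / (2 * Real.sin δ ^ 2)).toNNReal)
    (fun s ↦ lipschitzWith_radialField hδ hδ' s)
    (fun s hs ↦ (h₁ s hs).continuousWithinAt)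
    (fun _ hs ↦ hasDerivWithinAt_Ici_of_Icc h₁ hs)
    (fun s hs ↦ (h₂ s hs).continuousWithinAt)
    (fun _ hs ↦ hasDerivWithinAt_Ici_of_Icc h₂ hs) h0

/-- **Consistency of the horizons**: for `t' ≤ t` the truncated solutions on `[0, t]` and on
`[0, t']` agree on `[0, t']`. [folklore] -/
theorem truncSol_eq_truncSol_of_le (hc : ∀ ω, Continuous (U ω)) {δ : ℝ} (hδ : 0 < δ) (hδ' : δ ≤ Real.pi / 2) {t' : ℝ≥0} (ht' : t' ≤ t) (θ : ℝ) (ω : Ω) {s : ℝ}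
    (hs : s ∈ Icc (0 : ℝ) t') :
    truncSol (t := t) hc hδ hδ' θ ω s = truncSol (t := t') hc hδ hδ' θ ω s := by
  have hsub : Icc (0 : ℝ) t' ⊆ Icc (0 : ℝ) t := Icc_subset_Icc le_rfl (by exact_mod_cast ht')
  refine eqOn_of_hasDerivWithinAt hδ hδ' (V := U ω) (t := t') (fun u hu ↦ ?_)
    (fun u hu ↦ hasDerivWithinAt_truncSol hc hδ hδ' θ ω hu) ?_ hs
  · exact (hasDerivWithinAt_truncSol hc hδ hδ' θ ω (hsub hu)).mono hsub
  · rw [truncSol_zero, truncSol_zero]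

variable (U t δ) in
/-- **The truncated radial Bessel flow** `Y^δ : ℝ≥0 → Ω → ℝ`,
`Y^δₜ(ω) = Zₜ(ω) - (U ω t - U ω 0)` with `Z` the truncated solution on the horizon `[0, t]`: the
everywhere-defined process solving `Y^δₜ = θ + ∫₀ᵗ cotTrunc δ (Y^δ_s/2) ds - (Uₜ - U₀)`
(`argTrunc_eq_integral`); it is the radial Bessel flow of Lawler (2005), (6.12) / LSW (2002),
(2.9)–(2.11) as long as it stays in `[2δ, 2π - 2δ]`. [cite: Lawler2005, §6.4 eq. (6.12)] -/
def argTrunc (hc : ∀ ω, Continuous (U ω)) (hδ : 0 < δ) (hδ' : δ ≤ Real.pi / 2) (θ : ℝ) :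
    ℝ≥0 → Ω → ℝ :=
  fun t ω ↦ truncSol (t := t) hc hδ hδ' θ ω t - (U ω t - U ω 0)

/-- On `[0, t]` the truncated flow is computed from the truncated solution on the horizon
`[0, t]`. [folklore] -/
theorem argTrunc_eq_of_le (hc : ∀ ω, Continuous (U ω)) {δ : ℝ} (hδ : 0 < δ) (hδ' : δ ≤ Real.pi / 2) (θ : ℝ) (ω : Ω) {s : ℝ≥0} (hs : s ≤ t) :
    argTrunc U δ hc hδ hδ' θ s ω = truncSol (t := t) hc hδ hδ' θ ω s - (U ω s - U ω 0) := by
  rw [argTrunc, truncSol_eq_truncSol_of_le hc hδ hδ' hs θ ω ⟨s.coe_nonneg, le_rfl⟩]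

/-- The same, at real times `s ∈ [0, t]` read through `Real.toNNReal`. [folklore] -/
theorem argTrunc_toNNReal_eq_of_mem (hc : ∀ ω, Continuous (U ω)) {δ : ℝ} (hδ : 0 < δ) (hδ' : δ ≤ Real.pi / 2) (θ : ℝ) (ω : Ω) {s : ℝ} (hs : s ∈ Icc (0 : ℝ) t) :
    argTrunc U δ hc hδ hδ' θ s.toNNReal ω =
      truncSol (t := t) hc hδ hδ' θ ω s - (U ω s.toNNReal - U ω 0) := by
  rw [argTrunc_eq_of_le hc hδ hδ' θ ω ((Real.toNNReal_le_iff_le_coe).2 hs.2),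
    Real.coe_toNNReal _ hs.1]

/-- The truncated flow starts at `θ`. [folklore] -/
@[simp] theorem argTrunc_zero (hc : ∀ ω, Continuous (U ω)) {δ : ℝ} (hδ : 0 < δ) (hδ' : δ ≤ Real.pi / 2) (θ : ℝ) (ω : Ω) : argTrunc U δ hc hδ hδ' θ 0 ω = θ := by
  rw [argTrunc, NNReal.coe_zero, truncSol_zero, sub_self, sub_zero]

/-- **The truncated flow has continuous paths.** [folklore] -/
theorem continuous_argTrunc (hc : ∀ ω, Continuous (U ω)) {δ : ℝ} (hδ : 0 < δ) (hδ' : δ ≤ Real.pi / 2) (θ : ℝ) (ω : Ω) : Continuous fun s ↦ argTrunc U δ hc hδ hδ' θ s ω := by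
  -- continuity on each `[0, n]`, where the flow is given by one continuous truncated solution
  refine continuous_iff_continuousAt.2 fun s₀ ↦ ?_
  obtain ⟨n, hn⟩ := exists_nat_gt (s₀ : ℝ)
  have hmem : Iio (n : ℝ≥0) ∈ 𝓝 s₀ := Iio_mem_nhds (by exact_mod_cast hn)
  have heq : ∀ s ∈ Iio (n : ℝ≥0), argTrunc U δ hc hδ hδ' θ s ω =
      truncSol (t := (n : ℝ≥0)) hc hδ hδ' θ ω s - (U ω s - U ω 0) :=
    fun s hs ↦ argTrunc_eq_of_le hc hδ hδ' θ ω (le_of_lt hs)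
  have hcont : Continuous fun s : ℝ≥0 ↦
      truncSol (t := (n : ℝ≥0)) hc hδ hδ' θ ω s - (U ω s - U ω 0) :=
    ((continuous_truncSol hc hδ hδ' θ ω).comp NNReal.continuous_coe).sub
      ((hc ω).sub continuous_const)
  exact (hcont.continuousAt.congr (eventuallyEq_of_mem hmem fun s hs ↦ (heq s hs).symm))

/-- **FTC along the truncated solution**: `Z(t) - θ = ∫₀ᵗ F_δ(s, Z(s)) ds` on the horizon
`[0, t]`. [folklore] -/
theorem truncSol_sub_eq_integral (hc : ∀ ω, Continuous (U ω)) {δ : ℝ} (hδ : 0 < δ)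
    (hδ' : δ ≤ Real.pi / 2) (θ : ℝ) (ω : Ω) :
    truncSol (t := t) hc hδ hδ' θ ω t - θ =
      ∫ s in (0 : ℝ)..t, radialField (U ω) δ s (truncSol (t := t) hc hδ hδ' θ ω s) := by
  have hder : ∀ s ∈ Icc (0 : ℝ) t, HasDerivWithinAt (truncSol (t := t) hc hδ hδ' θ ω)
      (radialField (U ω) δ s (truncSol (t := t) hc hδ hδ' θ ω s)) (Icc (0 : ℝ) t) s :=
    fun s hs ↦ hasDerivWithinAt_truncSol hc hδ hδ' θ ω hs
  have hcontZ : ContinuousOn (truncSol (t := t) hc hδ hδ' θ ω) (Icc (0 : ℝ) t) :=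
    fun s hs ↦ (hder s hs).continuousWithinAt
  have hcontF : Continuous fun s ↦ radialField (U ω) δ s (truncSol (t := t) hc hδ hδ' θ ω s) :=
    continuous_radialField_comp (hc ω) hδ hδ' (continuous_truncSol hc hδ hδ' θ ω)
  rw [intervalIntegral.integral_eq_sub_of_hasDeriv_right_of_le t.coe_nonneg hcontZ
      (fun s hs ↦ (hder s (Ioo_subset_Icc_self hs)).mono_of_mem_nhdsWithin
        (mem_nhdsWithin_of_mem_nhds (Icc_mem_nhds hs.1 hs.2)))
      (hcontF.intervalIntegrable _ _), truncSol_zero]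

/-- **The integrated truncated radial Bessel equation**: for every `ω` and every `t`,
`Y^δₜ = θ + ∫₀ᵗ cotTrunc δ (Y^δ_s/2) ds - (Uₜ - U₀)`. (Fundamental theorem of calculus along the
truncated solution `Z = Y^δ + (U - U₀)`, whose derivative on `[0, t]` is
`cotTrunc δ ((Z - (U - U₀))/2) = cotTrunc δ (Y^δ/2)`.) Lawler (2005), (6.12)–(6.13); LSW (2002),
(2.11). [cite: Lawler2005, §6.4 eq. (6.12)] -/
theorem argTrunc_eq_integral (hc : ∀ ω, Continuous (U ω)) {δ : ℝ} (hδ : 0 < δ)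
    (hδ' : δ ≤ Real.pi / 2) (θ : ℝ) (ω : Ω) :
    argTrunc U δ hc hδ hδ' θ t ω = θ +
      (∫ s in (0 : ℝ)..t, cotTrunc δ (argTrunc U δ hc hδ hδ' θ s.toNNReal ω / 2)) -
        (U ω t - U ω 0) := by
  -- the integrand along the flow is the field along `Z`
  have hintegrand : ∀ s ∈ Icc (0 : ℝ) t,
      cotTrunc δ (argTrunc U δ hc hδ hδ' θ s.toNNReal ω / 2) =
        radialField (U ω) δ s (truncSol (t := t) hc hδ hδ' θ ω s) := by
    intro s hs
    rw [argTrunc_toNNReal_eq_of_mem hc hδ hδ' θ ω hs, radialField_apply]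
  have hint : ∫ s in (0 : ℝ)..t, cotTrunc δ (argTrunc U δ hc hδ hδ' θ s.toNNReal ω / 2) =
      ∫ s in (0 : ℝ)..t, radialField (U ω) δ s (truncSol (t := t) hc hδ hδ' θ ω s) :=
    intervalIntegral.integral_congr fun s hs ↦ hintegrand s (by
      rwa [uIcc_of_le t.coe_nonneg] at hs)
  rw [hint, ← truncSol_sub_eq_integral hc hδ hδ' θ ω, argTrunc_eq_of_le hc hδ hδ' θ ω le_rfl]
  ring

/-- **The truncated radial Bessel flow is measurable in `ω`** at each time `t`, with respect to any
σ-algebra making the path values at times `≤ t` measurable: `Y^δₜ` is a measurable functional of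
the path up to time `t`. [folklore] -/
theorem measurable_argTrunc (hc : ∀ ω, Continuous (U ω)) {δ : ℝ} (hδ : 0 < δ) (hδ' : δ ≤ Real.pi / 2) (hmeas : ∀ s, s ≤ t → Measurable fun ω ↦ U ω s) (θ : ℝ) :
    Measurable fun ω ↦ argTrunc U δ hc hδ hδ' θ t ω :=
  (measurable_truncSol hc hδ hδ' hmeas θ t).sub ((hmeas t le_rfl).sub (hmeas 0 (zero_le : (0 : ℝ≥0) ≤ t)))

/-- **The truncated radial Bessel flow is adapted** to any filtration to which the driving path is
adapted. [folklore] -/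
theorem adapted_argTrunc (hc : ∀ ω, Continuous (U ω)) {δ : ℝ} (hδ : 0 < δ) (hδ' : δ ≤ Real.pi / 2) {𝓕 : Filtration ℝ≥0 mΩ} (hU : ∀ s, Measurable[𝓕 s] fun ω ↦ U ω s)
    (θ : ℝ) : Adapted 𝓕 (argTrunc U δ hc hδ hδ' θ) := fun t ↦
  (measurable_argTrunc (mΩ := 𝓕 t) hc hδ hδ' (fun s hs ↦ (hU s).mono (𝓕.mono hs) le_rfl)
    θ)

/-! ### Uniqueness of the integrated equation -/

/-- **Continuous solutions of the integrated truncated equation are unique**: if a continuous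
`y : ℝ≥0 → ℝ` satisfies `yₛ = θ + ∫₀ˢ cotTrunc δ (y/2) - (U ω s - U ω 0)` for `s ≤ t`, then
`y = Y^δ(ω)` on `[0, t]` (the associated `Z = y + (U - U₀)` solves the truncated ODE: Grönwall).
[folklore] -/
theorem eqOn_argTrunc_of_integral_eq (hc : ∀ ω, Continuous (U ω)) {δ : ℝ} (hδ : 0 < δ) (hδ' : δ ≤ Real.pi / 2) (θ : ℝ) (ω : Ω) {y : ℝ≥0 → ℝ} (hy : Continuous y)
    (hyeq : ∀ s : ℝ≥0, s ≤ t →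
      y s = θ + (∫ u in (0 : ℝ)..s, cotTrunc δ (y u.toNNReal / 2)) - (U ω s - U ω 0)) :
    ∀ s : ℝ≥0, s ≤ t → y s = argTrunc U δ hc hδ hδ' θ s ω := by
  -- `Z := y + (U - U₀)` (in real time) solves the truncated ODE on `[0, t]`
  set Z : ℝ → ℝ := fun s ↦ y s.toNNReal + (U ω s.toNNReal - U ω 0) with hZ
  have hyc : Continuous fun s : ℝ ↦ y s.toNNReal := hy.comp continuous_real_toNNReal
  have hg : Continuous fun u : ℝ ↦ cotTrunc δ (y u.toNNReal / 2) :=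
    (continuous_cotTrunc hδ hδ').comp (hyc.div_const _)
  have hZeq : ∀ s ∈ Icc (0 : ℝ) t, Z s = θ + ∫ u in (0 : ℝ)..s, cotTrunc δ (y u.toNNReal / 2) := by
    intro s hs
    have h1 := hyeq s.toNNReal ((Real.toNNReal_le_iff_le_coe).2 hs.2)
    simp only [hZ, Real.coe_toNNReal _ hs.1] at h1 ⊢
    linarith
  have hZder : ∀ s ∈ Icc (0 : ℝ) t, HasDerivWithinAt Z (radialField (U ω) δ s (Z s))
      (Icc (0 : ℝ) t) s := by
    intro s hs
    have hprim : HasDerivAt (fun s ↦ θ + ∫ u in (0 : ℝ)..s, cotTrunc δ (y u.toNNReal / 2))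
        (cotTrunc δ (y s.toNNReal / 2)) s :=
      ((intervalIntegral.integral_hasDerivAt_right (hg.intervalIntegrable _ _)
        hg.aestronglyMeasurable.stronglyMeasurableAtFilter hg.continuousAt)).const_add θ
    have hfield : radialField (U ω) δ s (Z s) = cotTrunc δ (y s.toNNReal / 2) := by
      rw [radialField_apply, hZ]
      congr 1
      ring
    rw [hfield]
    exact (hprim.hasDerivWithinAt.congr_of_mem (fun u hu ↦ hZeq u hu) hs)
  have hEq := eqOn_of_hasDerivWithinAt hδ hδ' (V := U ω) (t := t) hZder
    (fun s hs ↦ hasDerivWithinAt_truncSol hc hδ hδ' θ ω hs) (by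
      rw [hZeq 0 ⟨le_rfl, t.coe_nonneg⟩, truncSol_zero, intervalIntegral.integral_same, add_zero])
  intro s hs
  have hs' : (s : ℝ) ∈ Icc (0 : ℝ) t := ⟨s.coe_nonneg, by exact_mod_cast hs⟩
  have h1 := hEq hs'
  simp only [hZ, Real.toNNReal_coe] at h1
  rw [argTrunc_eq_of_le hc hδ hδ' θ ω hs, ← h1]
  ring

end Parametrised

end RadialLoewner

end Literature.Probability.RandomPlanarGeometry
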